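import Mathlib
import HarnessLib
import Summits.Langlands.Langlands.Theses.SkinnerWilesDefectOne
import Summits.Langlands.Langlands.Theorems.ReducibleOrdinaryProModular.Negative.LevelAndRamification

/-!
# `EisensteinProModularSeed` (stmt-Langlands-12920) — Negative knowledge II: Borel-shaped
# representations never witness the conclusion; the Eisenstein congruence it carries

From the standing disprover's `Cruxes/EisensteinProModularSeed/Disproof.lean` (cdisprove gen 2,
cycle 1, §6.2 and §6.4), unconditional lemmas on the crux's conclusion
`∃ 𝒰 r r₀ q, r irreducible ∧ 𝒰.IsPadicallyAutomorphic r ∧ r.HasUpperTriangularIntegralModel r₀ ∧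
(diagonal of r₀ ≡ diagonal of ρ₀) ∧ …`:

* `not_isIrreducible_of_stableLine`, `not_isIrreducible_of_conj_upperTriangular` — a rank-two framed
  representation with a stable line / upper triangular in some frame is REDUCIBLE: no Borel-shaped `r`
  (sums and extensions of characters — the representations carried by Eisenstein or degree-character
  points of the big Hecke algebra) witnesses the conclusion;
* `trace_det_frob_of_isAssociated`, `trace_det_eq_of_integralModel`, `trace_det_congr_of_diag_congr`,
  `eisenstein_congruence_of_seed_conclusion` — `IsPadicallyAutomorphic r` + integral model + diagonal
  congruence give a CONTINUOUS `x : 𝕋(𝒰) → ℚ̄_p` with `x(T_{v,1})`, `q_v x(T_{v,2})` INTEGRAL and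
  `≡ (ρ₀)₀₀ + (ρ₀)₁₁`, `≡ (ρ₀)₀₀ (ρ₀)₁₁ (mod 𝔪)` at every arithmetic Frobenius off `bad` (the Eisenstein
  maximal ideal of the pair, arithmetic-Frobenius normalisation of `heckeFrobPoly`).

Imports the route file for the vocabulary cone and the sibling crux's Negative file for
`heckeFrobPoly_two`; no statement of the route is used or asserted. [folklore]
-/

set_option linter.dupNamespace false -- project-wide option (lakefile weak.linter.dupNamespace); `Summit.Langlands.Langlands` is the mandated namespace

namespace Summit.Langlands.Langlands.Theorems.EisensteinProModularSeed.Negative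

open Literature.NumberTheory.GaloisRepresentations
open Literature.NumberTheory.Automorphic
open Literature.NumberTheory.Automorphic.BigHeckeGLn
open Summit.Langlands.Langlands.Theorems.ReducibleOrdinaryProModular.Negative (heckeFrobPoly_two)
open IsDedekindDomain IsLocalRing Field Polynomial
open scoped NumberField Matrix

/-! ### Borel-shaped representations are reducible -/

section Borel

variable {G : Type*} [Group G] [TopologicalSpace G] {A : Type*} [Field A] [TopologicalSpace A]

/-- A rank-two framed representation over a field with a `G`-STABLE LINE is reducible
(Mathlib `Representation.IsIrreducible`: the subrepresentation lattice is simple; the line is a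
subrepresentation strictly between `⊥` and `⊤`). [folklore] -/
theorem not_isIrreducible_of_stableLine (r : FramedRep G A 2) (w : Fin 2 → A) (hw : w ≠ 0)
    (hst : ∀ g, ∃ c : A, ((r g : GL (Fin 2) A) : Matrix (Fin 2) (Fin 2) A) *ᵥ w = c • w) :
    ¬ r.IsIrreducible := by
  intro hirr
  let L : Subrepresentation r.toRepresentation :=
    { toSubmodule := Submodule.span A {w}
      apply_mem_toSubmodule := fun g v hv => by
        obtain ⟨a, rfl⟩ := Submodule.mem_span_singleton.mp hv
        obtain ⟨c, hc⟩ := hst g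
        rw [FramedRep.toRepresentation_apply_apply, Matrix.mulVec_smul, hc, smul_smul]
        exact Submodule.mem_span_singleton.mpr ⟨a * c, rfl⟩ }
  have hmem : ∀ x, x ∈ L ↔ x ∈ Submodule.span A {w} := fun x => Iff.rfl
  haveI : IsSimpleOrder (Subrepresentation r.toRepresentation) := hirr
  rcases IsSimpleOrder.eq_bot_or_eq_top L with hb | ht
  · have hwL : w ∈ L := (hmem w).mpr (Submodule.mem_span_singleton_self w)
    rw [hb] at hwL
    change w ∈ ((⊥ : Subrepresentation r.toRepresentation).toSubmodule) at hwL
    change w ∈ (⊥ : Submodule A (Fin 2 → A)) at hwL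
    exact hw ((Submodule.mem_bot A).mp hwL)
  · obtain ⟨i, hi⟩ : ∃ i, w i ≠ 0 := by
      by_contra hall
      push Not at hall
      exact hw (funext hall)
    have hne : ∀ i : Fin 2, i + 1 ≠ i := by decide
    obtain ⟨j, hj⟩ : ∃ j : Fin 2, j ≠ i := ⟨i + 1, hne i⟩
    have hjL : (Pi.single j 1 : Fin 2 → A) ∈ L := by
      rw [ht]
      change (Pi.single j 1 : Fin 2 → A) ∈ ((⊤ : Subrepresentation r.toRepresentation).toSubmodule)
      change (Pi.single j 1 : Fin 2 → A) ∈ (⊤ : Submodule A (Fin 2 → A))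
      exact Submodule.mem_top
    obtain ⟨c, hc⟩ := Submodule.mem_span_singleton.mp ((hmem _).mp hjL)
    have h1 : c * w i = 0 := by
      have := congrFun hc i
      rwa [Pi.smul_apply, smul_eq_mul, Pi.single_eq_of_ne hj.symm] at this
    have h2 : c * w j = 1 := by
      have := congrFun hc j
      rwa [Pi.smul_apply, smul_eq_mul, Pi.single_eq_same] at this
    rcases mul_eq_zero.mp h1 with hc0 | hwi
    · rw [hc0, zero_mul] at h2; exact zero_ne_one h2
    · exact hi hwi

omit [TopologicalSpace A] in
/-- The first column of an invertible `2 × 2` matrix over a field is non-zero (private copy of the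
lemma in `OrientedFrame.lean`, to keep the two files independent). [folklore] -/
private theorem col_zero_ne_zero' (P : GL (Fin 2) A) : (fun i => (P : Matrix (Fin 2) (Fin 2) A) i 0) ≠ 0 := by
  intro h
  have h0 : (P : Matrix (Fin 2) (Fin 2) A) 0 0 = 0 := congrFun h 0
  have h1 : (P : Matrix (Fin 2) (Fin 2) A) 1 0 = 0 := congrFun h 1
  have hdet : (P : Matrix (Fin 2) (Fin 2) A).det = 0 := by
    rw [Matrix.det_fin_two, h0, h1]; ring
  exact (Matrix.GeneralLinearGroup.det P).ne_zero
    (by rw [Matrix.GeneralLinearGroup.val_det_apply]; exact hdet)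

/-- **Upper triangular in some frame ⇒ reducible.** If `P⁻¹ r P` is upper triangular on all of `G`
(a global Borel shape: `χ₁ ⊕ χ₂`, `1 ⊕ ε`, any extension `(χ₁ ∗; 0 χ₂)`), the line spanned by the
first column of `P` is `G`-stable, so `r` is reducible. Hence no representation associated with an
Eisenstein / degree-character point of the big Hecke algebra witnesses a conclusion asking for
`r.toGaloisRep.IsIrreducible`. [folklore] -/
theorem not_isIrreducible_of_conj_upperTriangular (r : FramedRep G A 2) (P : GL (Fin 2) A)
    (h : ∀ g, (P⁻¹ * r g * P).val 1 0 = 0) : ¬ r.IsIrreducible := by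
  refine not_isIrreducible_of_stableLine r (fun i => (P : Matrix (Fin 2) (Fin 2) A) i 0)
    (col_zero_ne_zero' P) fun g => ⟨(P⁻¹ * r g * P).val 0 0, ?_⟩
  set B := P⁻¹ * r g * P with hBdef
  have hg : (B : Matrix (Fin 2) (Fin 2) A) 1 0 = 0 := h g
  have e : r g * P = P * B := by rw [hBdef]; group
  funext i
  have hi := congrArg (fun M : GL (Fin 2) A => (M : Matrix (Fin 2) (Fin 2) A) i 0) e
  simp only [Units.val_mul, Matrix.mul_apply, Fin.sum_univ_two] at hi
  simp only [Matrix.mulVec, dotProduct, Fin.sum_univ_two, Pi.smul_apply, smul_eq_mul]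
  rw [hi, hg, mul_zero, add_zero, mul_comm]

end Borel

/-! ### What association + integral model + diagonal congruence pin on the eigensystem -/

section Eisenstein

variable {F : Type} [Field F] [NumberField F] {p : ℕ} [Fact p.Prime]
  {O : ValuationSubring (PadicAlgCl p)}

/-- Entries of a framed representation with an integral model in the same frame (private copy of the
lemma in `OrientedFrame.lean`). [folklore] -/
private theorem entry_eq_of_integralModel' {p : ℕ} [Fact p.Prime] {O : ValuationSubring (PadicAlgCl p)}
    {G : Type*} [Group G] [TopologicalSpace G] {n : ℕ}
    {r : FramedRep G (PadicAlgCl p) n} {r₀ : G →* GL (Fin n) O}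
    (h : FramedRep.HasUpperTriangularIntegralModel r r₀) (g : G) (i j : Fin n) :
    (r g).val i j = ((r₀ g).val i j : PadicAlgCl p) := by
  rw [← h.1 g]; rfl

omit [NumberField F] [Fact p.Prime] in
/-- Trace and determinant from `charpoly M = X² − a₁ X + q a₂`. [folklore] -/
theorem trace_det_of_charpoly_eq_heckeFrobPoly {A : Type*} [CommRing A] [Nontrivial A]
    (M : Matrix (Fin 2) (Fin 2) A) (q : ℕ) (a : ℕ → A) (h : M.charpoly = heckeFrobPoly 2 q a) :
    M.trace = a 1 ∧ M.det = (q : A) * a 2 := by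
  rw [Matrix.charpoly_fin_two, heckeFrobPoly_two] at h
  have h1 := congrArg (fun f : A[X] => f.coeff 1) h
  have h0 := congrArg (fun f : A[X] => f.coeff 0) h
  simp only [coeff_add, coeff_sub, coeff_X_pow, coeff_C_mul, coeff_X_one, coeff_C_zero,
    coeff_X_zero, mul_one, mul_zero] at h1 h0
  norm_num at h1 h0
  exact ⟨h1, h0⟩

/-- **Association pins trace and determinant of Frobenius**: if `x : 𝕋(𝒰) → ℚ̄_p` is associated with
`r`, then at every good `v ∉ 𝒰.bad` and every arithmetic Frobenius `σ` above `v`,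
`tr r(σ) = x(T_{v,1})` and `det r(σ) = q_v x(T_{v,2})`. [folklore] -/
theorem trace_det_frob_of_isAssociated {𝒰 : TameLevel 2 F p}
    {x : CompletedCohomologyHeckeAlgebraGLn 𝒰 →+* PadicAlgCl p}
    {r : FramedGaloisRep F (PadicAlgCl p) 2} (h : 𝒰.IsAssociated x r)
    {v : HeightOneSpectrum (𝓞 F)} (hv : v ∉ 𝒰.bad) {𝔓 : Ideal (absIntegers (𝓞 F) F)}
    (h𝔓 : 𝔓 ∈ v.primesAbove) {σ : absoluteGaloisGroup F} (hσ : IsArithFrobAt (𝓞 F) σ 𝔓) :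
    (r σ).val.trace = x (𝒰.heckeT v 1) ∧
      (r σ).val.det = (Ideal.absNorm v.asIdeal : PadicAlgCl p) * x (𝒰.heckeT v 2) :=
  trace_det_of_charpoly_eq_heckeFrobPoly _ _ _ ((h v hv).2 𝔓 h𝔓 σ hσ)

omit [NumberField F] in
/-- Trace and determinant of an integrally modelled `r` are the images of those of the model.
[folklore] -/
theorem trace_det_eq_of_integralModel {G : Type*} [Group G] [TopologicalSpace G]
    {r : FramedRep G (PadicAlgCl p) 2} {r₀ : G →* GL (Fin 2) O}
    (h : FramedRep.HasUpperTriangularIntegralModel r r₀) (g : G) :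
    (r g).val.trace = (((r₀ g).val 0 0 + (r₀ g).val 1 1 : O) : PadicAlgCl p) ∧
      (r g).val.det = (((r₀ g).val.det : O) : PadicAlgCl p) := by
  constructor
  · rw [Matrix.trace_fin_two, entry_eq_of_integralModel' h g 0 0, entry_eq_of_integralModel' h g 1 1]
    push_cast; rfl
  · rw [Matrix.det_fin_two, Matrix.det_fin_two, entry_eq_of_integralModel' h g 0 0,
      entry_eq_of_integralModel' h g 0 1, entry_eq_of_integralModel' h g 1 0,
      entry_eq_of_integralModel' h g 1 1]
    push_cast; rfl

omit [NumberField F] in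
/-- For a residually upper-triangular model `r₀` congruent on the diagonal to `ρ₀`:
`tr r₀ ≡ (ρ₀)₀₀ + (ρ₀)₁₁` and `det r₀ ≡ (ρ₀)₀₀ (ρ₀)₁₁ (mod 𝔪)`. [folklore] -/
theorem trace_det_congr_of_diag_congr {G : Type*} [Group G] {r₀ ρ₀ : G →* GL (Fin 2) O}
    (hB : IsResiduallyUpperTriangular r₀)
    (hdiag : ∀ g, ((r₀ g).val 0 0 - (ρ₀ g).val 0 0 : O) ∈ maximalIdeal O ∧
      ((r₀ g).val 1 1 - (ρ₀ g).val 1 1 : O) ∈ maximalIdeal O) (g : G) :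
    ((r₀ g).val 0 0 + (r₀ g).val 1 1) - ((ρ₀ g).val 0 0 + (ρ₀ g).val 1 1) ∈ maximalIdeal O ∧
      (r₀ g).val.det - (ρ₀ g).val 0 0 * (ρ₀ g).val 1 1 ∈ maximalIdeal O := by
  obtain ⟨h0, h1⟩ := hdiag g
  have hc : (r₀ g).val 1 0 ∈ maximalIdeal O := ((isResiduallyUpperTriangular_two_iff r₀).mp hB) g
  constructor
  · have := Ideal.add_mem _ h0 h1
    convert this using 1; ring
  · rw [Matrix.det_fin_two]
    have := Ideal.sub_mem _ (Ideal.add_mem _ (Ideal.mul_mem_right ((r₀ g).val 1 1) _ h0)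
      (Ideal.mul_mem_left _ ((ρ₀ g).val 0 0) h1)) (Ideal.mul_mem_left _ ((r₀ g).val 0 1) hc)
    convert this using 1; ring

/-- **The Eisenstein congruence carried by the seed's conclusion.** If `r` is `p`-adically
automorphic of tame level `𝒰`, has a residually upper-triangular integral model `r₀`, and the diagonal
of `r₀` is congruent to that of the given datum `ρ₀` (the crux's clauses 2–4), then there is a
CONTINUOUS eigensystem `x : 𝕋(𝒰) → ℚ̄_p` such that at every good place and every arithmetic Frobenius
`σ`: `x(T_{v,1})` and `q_v x(T_{v,2})` are INTEGRAL, `x(T_{v,1}) ≡ (ρ₀ σ)₀₀ + (ρ₀ σ)₁₁` and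
`q_v x(T_{v,2}) ≡ (ρ₀ σ)₀₀ (ρ₀ σ)₁₁ (mod 𝔪)` — `x` lies over the Eisenstein maximal ideal of the pair
(arithmetic-Frobenius normalisation). [folklore] -/
theorem eisenstein_congruence_of_seed_conclusion {𝒰 : TameLevel 2 F p}
    {r : FramedGaloisRep F (PadicAlgCl p) 2}
    {r₀ ρ₀ : absoluteGaloisGroup F →* Matrix.GeneralLinearGroup (Fin 2) O}
    (hpa : 𝒰.IsPadicallyAutomorphic r) (hmod : r.HasUpperTriangularIntegralModel r₀)
    (hdiag : ∀ g, ((r₀ g).val 0 0 - (ρ₀ g).val 0 0 : O) ∈ maximalIdeal O ∧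
      ((r₀ g).val 1 1 - (ρ₀ g).val 1 1 : O) ∈ maximalIdeal O) :
    ∃ x : CompletedCohomologyHeckeAlgebraGLn 𝒰 →+* PadicAlgCl p, Continuous x ∧
      ∀ v ∉ 𝒰.bad, ∀ 𝔓 ∈ v.primesAbove, ∀ σ : absoluteGaloisGroup F, IsArithFrobAt (𝓞 F) σ 𝔓 →
        ∃ t d : O, (t : PadicAlgCl p) = x (𝒰.heckeT v 1) ∧
          (d : PadicAlgCl p) = (Ideal.absNorm v.asIdeal : PadicAlgCl p) * x (𝒰.heckeT v 2) ∧
          t - ((ρ₀ σ).val 0 0 + (ρ₀ σ).val 1 1) ∈ maximalIdeal O ∧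
          d - (ρ₀ σ).val 0 0 * (ρ₀ σ).val 1 1 ∈ maximalIdeal O := by
  obtain ⟨x, hxc, hx⟩ := hpa
  refine ⟨x, hxc, fun v hv 𝔓 h𝔓 σ hσ => ?_⟩
  obtain ⟨htr, hdet⟩ := trace_det_frob_of_isAssociated hx hv h𝔓 hσ
  obtain ⟨htr₀, hdet₀⟩ := trace_det_eq_of_integralModel hmod σ
  obtain ⟨ctr, cdet⟩ := trace_det_congr_of_diag_congr hmod.2 hdiag σ
  exact ⟨(r₀ σ).val 0 0 + (r₀ σ).val 1 1, (r₀ σ).val.det, by rw [← htr₀, htr],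
    by rw [← hdet₀, hdet], ctr, cdet⟩

end Eisenstein

end Summit.Langlands.Langlands.Theorems.EisensteinProModularSeed.Negative
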